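import Summits.KontsevichZagierPeriods.KontsevichZagierPeriods.Theorems.XMapPeriodTransfer.Negative.ValueSide

/-!
# `XMapKernel` (stmt-KontsevichZagierPeriods-10663, route IsogenyCertificates) — line
`derived-datum-quasi-periods`, stub `stub_etaCellCollapse` (formal bookkeeping in `KZ.FormalRep`)

**Collapse of the (ω, η)-egg cell.** For a three-real-root cubic `P = x³ + Ax + B` (`4A³ + 27B² < 0`) let
`egg(A,B) = {P > 0} ∖ (its unbounded component)`, `Ω = ∫_egg dx/√P`, `H = ∫_egg x dx/√P`. Given

* (S) honest representations `R(A,B,a₀,a₁) = [egg(A,B), (a₀ + a₁x)/√P]` (`a₀, a₁ ∈ ℚ`),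
* (E) the ENGINE: along an egg-regular coprime x-rational isogeny datum `(A,B) → (A',B')` every egg
  representation of either curve is KZ-equivalent to an egg representation of the other,
* (I) INDEPENDENCE: the numbers `Ω(i), H(i)` of finitely many such curves, pairwise not joined by a
  datum, are `ℚ`-linearly independent,

every element of value `0` of the subgroup generated by the egg representations lies in
`KZ.relations`. Proof (the architecture of `XMapKernelStubs.CellCollapse.stub_cellCollapse`, with
`KZ.relations` in place of the enlarged move group and coefficients in `ℚ × ℚ`): work in
`Q := FormalRep ⧸ relations`. (1) `(a₀,a₁) ↦ [R(A,B,a₀,a₁)]` is ADDITIVE `ℚ × ℚ → Q` (rule (1b)), and a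
generator `[r]` with the egg domain and integrand `= (a₀ + a₁x)/√P` on it equals `[R(A,B,a₀,a₁)]` in `Q`
(one rule-(1b) move against a zero representation); so every element of the cell closure is, in `Q`,
`∑_p ψ_p(a_p)` for a finitely supported `a : ℤ × ℤ →₀ ℚ × ℚ` on three-real-root curves, with value
`∑_p (a_p.1 Ω(p) + a_p.2 H(p))` (`AddSubgroup.closure_induction`; the value of `[egg, (a₀ + a₁x)/√P]` is
`a₀Ω + a₁H`, the integrability of `1/√P`, `x/√P` on the egg being inherited from `R(A,B,1,0)`,
`R(A,B,0,1)`). (2) If two distinct curves `p ≠ p'` of the support are joined, (E) gives `b ∈ ℚ × ℚ` with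
`R(p, a_p) ∼ R(p', b)`: equal classes in `Q`, equal values (soundness of the calculus), so the `p`-term
moves onto `p'` and the support shrinks. (3) When the support is pairwise non-joined, (I) kills every
coefficient: the support is empty. Induction on the size of the support.

References: Kontsevich–Zagier 2001 §1.2, rule (1); the transcendence input enters only through (I).
-/

noncomputable section

namespace Summit.KontsevichZagierPeriods.IsogenyCertificates.XMapKernelStubs.EtaCellCollapse

open scoped BigOperators
open Polynomial Set MeasureTheory
open Literature.NumberTheory.Transcendental
open Summit.KontsevichZagierPeriods.IsogenyCertificates.XMapPeriodTransferValue

/-- The value of a one-dimensional representation whose integrand is `(a₀ + a₁x)/√P` on its domain `D`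
is `a₀ ∫_D dx/√P + a₁ ∫_D x dx/√P`, provided `1/√P` and `x/√P` are integrable on `D`.
[cite: KontsevichZagier2001, §1.1] -/
theorem value_eq_of_eqOn {A B : ℤ} {D : Set (Fin 1 → ℝ)} {a₀ a₁ : ℚ}
    (h₀ : IntegrableOn (fun x : Fin 1 → ℝ => 1 / Real.sqrt (x 0 ^ 3 + (A : ℝ) * x 0 + (B : ℝ))) D)
    (h₁ : IntegrableOn (fun x : Fin 1 → ℝ => x 0 / Real.sqrt (x 0 ^ 3 + (A : ℝ) * x 0 + (B : ℝ))) D)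
    (r : KZ.IntegralRep 1) (hd : r.domain = D)
    (he : EqOn r.integrand
      (fun x => ((a₀ : ℝ) + (a₁ : ℝ) * x 0) / Real.sqrt (x 0 ^ 3 + (A : ℝ) * x 0 + (B : ℝ))) r.domain) :
    r.value = (a₀ : ℝ) * (∫ x in D, 1 / Real.sqrt (x 0 ^ 3 + (A : ℝ) * x 0 + (B : ℝ))) +
      (a₁ : ℝ) * (∫ x in D, x 0 / Real.sqrt (x 0 ^ 3 + (A : ℝ) * x 0 + (B : ℝ))) := by
  rw [KZ.IntegralRep.value, setIntegral_congr_fun (KZ.IntegralRep.measurableSet_domain_holds r) he, hd,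
    ← integral_const_mul, ← integral_const_mul, ← integral_add (h₀.const_mul _) (h₁.const_mul _)]
  congr 1
  ext x
  ring

/-- **Stub `stub_etaCellCollapse` of line derived-datum-quasi-periods (collapse of the (ω, η)-egg cell).**
Egg representations exist (S), the engine transports them both ways along egg-regular coprime data (E),
and the real periods and quasi-periods of pairwise non-joined three-real-root curves are `ℚ`-linearly
independent (I) ⟹ every element of value `0` of the subgroup generated by the egg representations
`[egg(A,B), (a₀ + a₁x)/√P]` is a relation of the KZ calculus. See the module docstring for the proof.
[cite: KontsevichZagier2001, §1.2] -/
theorem stub_etaCellCollapse :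
    (∀ (A B : ℤ) (a₀ a₁ : ℚ), 4 * A ^ 3 + 27 * B ^ 2 < 0 → ∃ r : KZ.IntegralRep 1,
      r.domain = {x | x 0 ∈ {y : ℝ | 0 < y ^ 3 + (A : ℝ) * y + (B : ℝ)} \
        connectedComponentIn {y : ℝ | 0 < y ^ 3 + (A : ℝ) * y + (B : ℝ)} (1 + |(A : ℝ)| + |(B : ℝ)|)} ∧
      r.integrand = fun x => ((a₀ : ℝ) + (a₁ : ℝ) * x 0) / Real.sqrt (x 0 ^ 3 + (A : ℝ) * x 0 + (B : ℝ))) →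
    (∀ (A B A' B' : ℤ), 4 * A ^ 3 + 27 * B ^ 2 < 0 → 4 * A' ^ 3 + 27 * B' ^ 2 < 0 →
      (∃ (f g : ℚ[X]) (c : ℚ), IsCoprime f g ∧ derivative f * g - f * derivative g ≠ 0 ∧
        C (c ^ 2) * g * (f ^ 3 + C (A' : ℚ) * f * g ^ 2 + C (B' : ℚ) * g ^ 3) =
          (X ^ 3 + C (A : ℚ) * X + C (B : ℚ)) * (derivative f * g - f * derivative g) ^ 2 ∧
        ∀ y ∈ closure ({y : ℝ | 0 < y ^ 3 + (A : ℝ) * y + (B : ℝ)} \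
          connectedComponentIn {y : ℝ | 0 < y ^ 3 + (A : ℝ) * y + (B : ℝ)} (1 + |(A : ℝ)| + |(B : ℝ)|)),
          aeval y g ≠ 0) →
      (∀ b₀ b₁ : ℚ, ∃ a₀ a₁ : ℚ, ∀ (r r' : KZ.IntegralRep 1),
        r.domain = {x | x 0 ∈ {y : ℝ | 0 < y ^ 3 + (A : ℝ) * y + (B : ℝ)} \
          connectedComponentIn {y : ℝ | 0 < y ^ 3 + (A : ℝ) * y + (B : ℝ)} (1 + |(A : ℝ)| + |(B : ℝ)|)} →
        EqOn r.integrand (fun x => ((a₀ : ℝ) + (a₁ : ℝ) * x 0) /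
          Real.sqrt (x 0 ^ 3 + (A : ℝ) * x 0 + (B : ℝ))) r.domain →
        r'.domain = {x | x 0 ∈ {y : ℝ | 0 < y ^ 3 + (A' : ℝ) * y + (B' : ℝ)} \
          connectedComponentIn {y : ℝ | 0 < y ^ 3 + (A' : ℝ) * y + (B' : ℝ)} (1 + |(A' : ℝ)| + |(B' : ℝ)|)} →
        EqOn r'.integrand (fun x => ((b₀ : ℝ) + (b₁ : ℝ) * x 0) /
          Real.sqrt (x 0 ^ 3 + (A' : ℝ) * x 0 + (B' : ℝ))) r'.domain →
        KZ.Equivalent r r') ∧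
      (∀ a₀ a₁ : ℚ, ∃ b₀ b₁ : ℚ, ∀ (r r' : KZ.IntegralRep 1),
        r.domain = {x | x 0 ∈ {y : ℝ | 0 < y ^ 3 + (A : ℝ) * y + (B : ℝ)} \
          connectedComponentIn {y : ℝ | 0 < y ^ 3 + (A : ℝ) * y + (B : ℝ)} (1 + |(A : ℝ)| + |(B : ℝ)|)} →
        EqOn r.integrand (fun x => ((a₀ : ℝ) + (a₁ : ℝ) * x 0) /
          Real.sqrt (x 0 ^ 3 + (A : ℝ) * x 0 + (B : ℝ))) r.domain →
        r'.domain = {x | x 0 ∈ {y : ℝ | 0 < y ^ 3 + (A' : ℝ) * y + (B' : ℝ)} \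
          connectedComponentIn {y : ℝ | 0 < y ^ 3 + (A' : ℝ) * y + (B' : ℝ)} (1 + |(A' : ℝ)| + |(B' : ℝ)|)} →
        EqOn r'.integrand (fun x => ((b₀ : ℝ) + (b₁ : ℝ) * x 0) /
          Real.sqrt (x 0 ^ 3 + (A' : ℝ) * x 0 + (B' : ℝ))) r'.domain →
        KZ.Equivalent r r')) →
    (∀ (k : ℕ) (A B : Fin k → ℤ) (p q : Fin k → ℚ), (∀ i, 4 * A i ^ 3 + 27 * B i ^ 2 < 0) →
      (∀ i j, i ≠ j → ¬ ∃ (f g : ℚ[X]) (c : ℚ), IsCoprime f g ∧ derivative f * g - f * derivative g ≠ 0 ∧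
        C (c ^ 2) * g * (f ^ 3 + C (A j : ℚ) * f * g ^ 2 + C (B j : ℚ) * g ^ 3) =
          (X ^ 3 + C (A i : ℚ) * X + C (B i : ℚ)) * (derivative f * g - f * derivative g) ^ 2 ∧
        ∀ y ∈ closure ({y : ℝ | 0 < y ^ 3 + (A i : ℝ) * y + (B i : ℝ)} \
          connectedComponentIn {y : ℝ | 0 < y ^ 3 + (A i : ℝ) * y + (B i : ℝ)} (1 + |(A i : ℝ)| + |(B i : ℝ)|)),
          aeval y g ≠ 0) →
      ∑ i, ((p i : ℝ) * (∫ x in {x : Fin 1 → ℝ | x 0 ∈ {y : ℝ | 0 < y ^ 3 + (A i : ℝ) * y + (B i : ℝ)} \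
          connectedComponentIn {y : ℝ | 0 < y ^ 3 + (A i : ℝ) * y + (B i : ℝ)} (1 + |(A i : ℝ)| + |(B i : ℝ)|)},
          1 / Real.sqrt (x 0 ^ 3 + (A i : ℝ) * x 0 + (B i : ℝ))) +
        (q i : ℝ) * (∫ x in {x : Fin 1 → ℝ | x 0 ∈ {y : ℝ | 0 < y ^ 3 + (A i : ℝ) * y + (B i : ℝ)} \
          connectedComponentIn {y : ℝ | 0 < y ^ 3 + (A i : ℝ) * y + (B i : ℝ)} (1 + |(A i : ℝ)| + |(B i : ℝ)|)},
          x 0 / Real.sqrt (x 0 ^ 3 + (A i : ℝ) * x 0 + (B i : ℝ)))) = 0 →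
      ∀ i, p i = 0 ∧ q i = 0) →
    ∀ c ∈ AddSubgroup.closure {d : KZ.FormalRep | ∃ (A B : ℤ) (a₀ a₁ : ℚ) (r : KZ.IntegralRep 1),
        4 * A ^ 3 + 27 * B ^ 2 < 0 ∧
        r.domain = {x | x 0 ∈ {y : ℝ | 0 < y ^ 3 + (A : ℝ) * y + (B : ℝ)} \
          connectedComponentIn {y : ℝ | 0 < y ^ 3 + (A : ℝ) * y + (B : ℝ)} (1 + |(A : ℝ)| + |(B : ℝ)|)} ∧
        EqOn r.integrand (fun x => ((a₀ : ℝ) + (a₁ : ℝ) * x 0) /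
          Real.sqrt (x 0 ^ 3 + (A : ℝ) * x 0 + (B : ℝ))) r.domain ∧
        d = KZ.of r},
      KZ.eval c = 0 → c ∈ KZ.relations := by
  intro hS hEng hI c hc hc0
  classical
  -- (S): canonical egg representations `R A B a₀ a₁ h = [egg(A,B), (a₀ + a₁x)/√P]`
  choose R hRd hRi using hS
  have hReq : ∀ (p : ℤ × ℤ) (h : 4 * p.1 ^ 3 + 27 * p.2 ^ 2 < 0) (a₀ a₁ : ℚ),
      EqOn (R p.1 p.2 a₀ a₁ h).integrand
        (fun x => ((a₀ : ℝ) + (a₁ : ℝ) * x 0) / Real.sqrt (x 0 ^ 3 + (p.1 : ℝ) * x 0 + (p.2 : ℝ)))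
        (R p.1 p.2 a₀ a₁ h).domain := fun p h a₀ a₁ x _ => by rw [hRi]
  -- the real period `ω p` and the quasi-period `η p` of the egg of the curve `p = (A, B)`
  let ω : ℤ × ℤ → ℝ := fun p =>
    ∫ x in {x : Fin 1 → ℝ | x 0 ∈ {y : ℝ | 0 < y ^ 3 + (p.1 : ℝ) * y + (p.2 : ℝ)} \
      connectedComponentIn {y : ℝ | 0 < y ^ 3 + (p.1 : ℝ) * y + (p.2 : ℝ)} (1 + |(p.1 : ℝ)| + |(p.2 : ℝ)|)},
      1 / Real.sqrt (x 0 ^ 3 + (p.1 : ℝ) * x 0 + (p.2 : ℝ))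
  let η : ℤ × ℤ → ℝ := fun p =>
    ∫ x in {x : Fin 1 → ℝ | x 0 ∈ {y : ℝ | 0 < y ^ 3 + (p.1 : ℝ) * y + (p.2 : ℝ)} \
      connectedComponentIn {y : ℝ | 0 < y ^ 3 + (p.1 : ℝ) * y + (p.2 : ℝ)} (1 + |(p.1 : ℝ)| + |(p.2 : ℝ)|)},
      x 0 / Real.sqrt (x 0 ^ 3 + (p.1 : ℝ) * x 0 + (p.2 : ℝ))
  -- integrability of `1/√P` and `x/√P` on the egg, inherited from `R p 1 0` and `R p 0 1`
  have hω : ∀ (p : ℤ × ℤ) (h : 4 * p.1 ^ 3 + 27 * p.2 ^ 2 < 0),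
      IntegrableOn (fun x : Fin 1 → ℝ => 1 / Real.sqrt (x 0 ^ 3 + (p.1 : ℝ) * x 0 + (p.2 : ℝ)))
        {x : Fin 1 → ℝ | x 0 ∈ {y : ℝ | 0 < y ^ 3 + (p.1 : ℝ) * y + (p.2 : ℝ)} \
          connectedComponentIn {y : ℝ | 0 < y ^ 3 + (p.1 : ℝ) * y + (p.2 : ℝ)}
            (1 + |(p.1 : ℝ)| + |(p.2 : ℝ)|)} := by
    intro p h
    have hi := (R p.1 p.2 1 0 h).integrableOn
    rw [hRd, hRi] at hi
    simpa only [Rat.cast_one, Rat.cast_zero, zero_mul, add_zero] using hi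
  have hη : ∀ (p : ℤ × ℤ) (h : 4 * p.1 ^ 3 + 27 * p.2 ^ 2 < 0),
      IntegrableOn (fun x : Fin 1 → ℝ => x 0 / Real.sqrt (x 0 ^ 3 + (p.1 : ℝ) * x 0 + (p.2 : ℝ)))
        {x : Fin 1 → ℝ | x 0 ∈ {y : ℝ | 0 < y ^ 3 + (p.1 : ℝ) * y + (p.2 : ℝ)} \
          connectedComponentIn {y : ℝ | 0 < y ^ 3 + (p.1 : ℝ) * y + (p.2 : ℝ)}
            (1 + |(p.1 : ℝ)| + |(p.2 : ℝ)|)} := by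
    intro p h
    have hi := (R p.1 p.2 0 1 h).integrableOn
    rw [hRd, hRi] at hi
    simpa only [Rat.cast_one, Rat.cast_zero, one_mul, zero_add] using hi
  -- the value of an egg representation with integrand `= (a₀ + a₁x)/√P` on the egg is `a₀ ω + a₁ η`
  have hvalR : ∀ (p : ℤ × ℤ) (h : 4 * p.1 ^ 3 + 27 * p.2 ^ 2 < 0) (r : KZ.IntegralRep 1),
      r.domain = {x : Fin 1 → ℝ | x 0 ∈ {y : ℝ | 0 < y ^ 3 + (p.1 : ℝ) * y + (p.2 : ℝ)} \
        connectedComponentIn {y : ℝ | 0 < y ^ 3 + (p.1 : ℝ) * y + (p.2 : ℝ)}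
          (1 + |(p.1 : ℝ)| + |(p.2 : ℝ)|)} →
      ∀ (a₀ a₁ : ℚ), EqOn r.integrand
        (fun x => ((a₀ : ℝ) + (a₁ : ℝ) * x 0) / Real.sqrt (x 0 ^ 3 + (p.1 : ℝ) * x 0 + (p.2 : ℝ)))
          r.domain →
      r.value = (a₀ : ℝ) * ω p + (a₁ : ℝ) * η p :=
    fun p h r hd a₀ a₁ he => value_eq_of_eqOn (hω p h) (hη p h) r hd he
  have hvalR' : ∀ (p : ℤ × ℤ) (h : 4 * p.1 ^ 3 + 27 * p.2 ^ 2 < 0) (a₀ a₁ : ℚ),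
      (R p.1 p.2 a₀ a₁ h).value = (a₀ : ℝ) * ω p + (a₁ : ℝ) * η p :=
    fun p h a₀ a₁ => hvalR p h _ (hRd _ _ _ _ h) a₀ a₁ (hReq p h a₀ a₁)
  -- the quotient by the relations of the calculus
  let π : KZ.FormalRep →+ KZ.FormalRep ⧸ KZ.relations := QuotientAddGroup.mk' KZ.relations
  have hπ : ∀ x, π x = 0 ↔ x ∈ KZ.relations := fun x => QuotientAddGroup.eq_zero_iff x
  -- additivity of `(a₀, a₁) ↦ [R(p, a₀, a₁)]` modulo relations: one rule-(1b) move
  have hadd : ∀ (p : ℤ × ℤ) (h : 4 * p.1 ^ 3 + 27 * p.2 ^ 2 < 0) (t u : ℚ × ℚ),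
      π (KZ.of (R p.1 p.2 (t + u).1 (t + u).2 h)) =
        π (KZ.of (R p.1 p.2 t.1 t.2 h)) + π (KZ.of (R p.1 p.2 u.1 u.2 h)) := by
    intro p h t u
    have hmem : KZ.of (R p.1 p.2 (t + u).1 (t + u).2 h) - KZ.of (R p.1 p.2 t.1 t.2 h) -
        KZ.of (R p.1 p.2 u.1 u.2 h) ∈ KZ.relations := by
      refine KZ.integrandAddRel_subset_relations ⟨1, _, _, _, by rw [hRd, hRd], by rw [hRd, hRd], ?_, rfl⟩
      intro x _
      simp only [hRi, Pi.add_apply, Prod.fst_add, Prod.snd_add, Rat.cast_add]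
      ring
    have h0 := (hπ _).2 hmem
    rw [map_sub, map_sub, sub_sub, sub_eq_zero] at h0
    exact h0
  -- the per-curve homomorphisms `ψ p : ℚ × ℚ →+ Q` and their values `φ p : ℚ × ℚ →+ ℝ`
  let ψ : ℤ × ℤ → (ℚ × ℚ →+ KZ.FormalRep ⧸ KZ.relations) := fun p =>
    if h : 4 * p.1 ^ 3 + 27 * p.2 ^ 2 < 0 then
      AddMonoidHom.mk' (fun t => π (KZ.of (R p.1 p.2 t.1 t.2 h))) (hadd p h)
    else 0
  have hψ : ∀ (p : ℤ × ℤ) (h : 4 * p.1 ^ 3 + 27 * p.2 ^ 2 < 0) (t : ℚ × ℚ),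
      ψ p t = π (KZ.of (R p.1 p.2 t.1 t.2 h)) := by
    intro p h t
    simp only [ψ, dif_pos h, AddMonoidHom.mk'_apply]
  let φ : ℤ × ℤ → (ℚ × ℚ →+ ℝ) := fun p =>
    AddMonoidHom.mk' (fun t => (t.1 : ℝ) * ω p + (t.2 : ℝ) * η p) fun t u => by
      simp only [Prod.fst_add, Prod.snd_add, Rat.cast_add]
      ring
  -- linear extensions to finitely supported coefficient vectors
  let Ψ : (ℤ × ℤ →₀ ℚ × ℚ) →+ KZ.FormalRep ⧸ KZ.relations := Finsupp.liftAddHom ψ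
  let E : (ℤ × ℤ →₀ ℚ × ℚ) →+ ℝ := Finsupp.liftAddHom φ
  have hΨ1 : ∀ p t, Ψ (Finsupp.single p t) = ψ p t := fun p t => Finsupp.liftAddHom_apply_single ψ p t
  have hE1 : ∀ p t, E (Finsupp.single p t) = (t.1 : ℝ) * ω p + (t.2 : ℝ) * η p := fun p t => by
    simp only [E, Finsupp.liftAddHom_apply_single, φ, AddMonoidHom.mk'_apply]
  have hEsum : ∀ a : ℤ × ℤ →₀ ℚ × ℚ,
      E a = ∑ p ∈ a.support, (((a p).1 : ℝ) * ω p + ((a p).2 : ℝ) * η p) := fun a => by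
    simp only [E, Finsupp.liftAddHom_apply, Finsupp.sum, φ, AddMonoidHom.mk'_apply]
  -- STEP A: normal form of the cell closure in `Q`, with its value
  have stepA : ∀ x ∈ AddSubgroup.closure {d : KZ.FormalRep | ∃ (A B : ℤ) (a₀ a₁ : ℚ)
      (r : KZ.IntegralRep 1), 4 * A ^ 3 + 27 * B ^ 2 < 0 ∧
      r.domain = {x | x 0 ∈ {y : ℝ | 0 < y ^ 3 + (A : ℝ) * y + (B : ℝ)} \
        connectedComponentIn {y : ℝ | 0 < y ^ 3 + (A : ℝ) * y + (B : ℝ)} (1 + |(A : ℝ)| + |(B : ℝ)|)} ∧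
      EqOn r.integrand (fun x => ((a₀ : ℝ) + (a₁ : ℝ) * x 0) /
        Real.sqrt (x 0 ^ 3 + (A : ℝ) * x 0 + (B : ℝ))) r.domain ∧
      d = KZ.of r},
      ∃ a : ℤ × ℤ →₀ ℚ × ℚ, (∀ p ∈ a.support, 4 * p.1 ^ 3 + 27 * p.2 ^ 2 < 0) ∧
        π x = Ψ a ∧ KZ.eval x = E a := by
    intro x hx
    induction hx using AddSubgroup.closure_induction with
    | mem x hx =>
      obtain ⟨A, B, a₀, a₁, r, hns, hd, he, rfl⟩ := hx
      refine ⟨Finsupp.single (A, B) (a₀, a₁), fun p hp => ?_, ?_, ?_⟩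
      · have := Finsupp.support_single_subset hp
        rw [Finset.mem_singleton] at this
        rw [this]
        exact hns
      · -- `[r] = [R(A,B,a₀,a₁)]` in `Q`: same domain, integrands agree on it
        rw [hΨ1, hψ (A, B) hns]
        have heq : KZ.Equivalent r (R A B a₀ a₁ hns) :=
          equivalent_of_eqOn r (R A B a₀ a₁ hns) (by rw [hRd, hd]) (by rw [hRi]; exact he)
        have h0 := (hπ _).2 heq
        rw [map_sub, sub_eq_zero] at h0
        exact h0
      · rw [hE1, KZ.eval_of]
        exact hvalR (A, B) hns r hd a₀ a₁ he
    | zero => exact ⟨0, by simp, by simp, by simp⟩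
    | add x y _ _ ihx ihy =>
      obtain ⟨a, ha, hπa, hEa⟩ := ihx
      obtain ⟨b, hb, hπb, hEb⟩ := ihy
      refine ⟨a + b, fun p hp => ?_, by rw [map_add, map_add, hπa, hπb],
        by rw [map_add, map_add, hEa, hEb]⟩
      rcases Finset.mem_union.1 (Finsupp.support_add hp) with h | h
      · exact ha p h
      · exact hb p h
    | neg x _ ih =>
      obtain ⟨a, ha, hπa, hEa⟩ := ih
      exact ⟨-a, fun p hp => ha p (by rwa [Finsupp.support_neg] at hp), by rw [map_neg, map_neg, hπa],
        by rw [map_neg, map_neg, hEa]⟩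
  -- STEP B: shrink the support along data, induction on its size
  have stepB : ∀ (n : ℕ) (a : ℤ × ℤ →₀ ℚ × ℚ), a.support.card ≤ n →
      (∀ p ∈ a.support, 4 * p.1 ^ 3 + 27 * p.2 ^ 2 < 0) → E a = 0 → Ψ a = 0 := by
    intro n
    induction n with
    | zero =>
      intro a hcard _ _
      have ha : a = 0 := by
        rwa [Nat.le_zero, Finset.card_eq_zero, Finsupp.support_eq_empty] at hcard
      rw [ha, map_zero]
    | succ n ih =>
      intro a hcard hns hEa
      by_cases hrel : ∃ p ∈ a.support, ∃ p' ∈ a.support, p ≠ p' ∧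
          ∃ (f g : ℚ[X]) (c : ℚ), IsCoprime f g ∧ derivative f * g - f * derivative g ≠ 0 ∧
            C (c ^ 2) * g * (f ^ 3 + C (p'.1 : ℚ) * f * g ^ 2 + C (p'.2 : ℚ) * g ^ 3) =
              (X ^ 3 + C (p.1 : ℚ) * X + C (p.2 : ℚ)) * (derivative f * g - f * derivative g) ^ 2 ∧
            ∀ y ∈ closure ({y : ℝ | 0 < y ^ 3 + (p.1 : ℝ) * y + (p.2 : ℝ)} \
              connectedComponentIn {y : ℝ | 0 < y ^ 3 + (p.1 : ℝ) * y + (p.2 : ℝ)}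
                (1 + |(p.1 : ℝ)| + |(p.2 : ℝ)|)), aeval y g ≠ 0
      · -- two joined curves `p ≠ p'` in the support: move the `p`-term onto `p'` by the engine
        obtain ⟨p, hp, p', hp', hpp', hjoin⟩ := hrel
        have hnp := hns p hp
        have hnp' := hns p' hp'
        obtain ⟨b₀, b₁, hb⟩ := (hEng p.1 p.2 p'.1 p'.2 hnp hnp' hjoin).2 (a p).1 (a p).2
        have heqv : KZ.Equivalent (R p.1 p.2 (a p).1 (a p).2 hnp) (R p'.1 p'.2 b₀ b₁ hnp') :=
          hb _ _ (hRd _ _ _ _ hnp) (hReq p hnp _ _) (hRd _ _ _ _ hnp') (hReq p' hnp' _ _)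
        -- equal classes modulo relations …
        have key : ψ p (a p) = ψ p' (b₀, b₁) := by
          rw [hψ p hnp, hψ p' hnp', ← sub_eq_zero, ← map_sub, hπ]
          exact heqv
        -- … and equal values (soundness of the calculus)
        have hval : ((a p).1 : ℝ) * ω p + ((a p).2 : ℝ) * η p = (b₀ : ℝ) * ω p' + (b₁ : ℝ) * η p' := by
          have hv := KZ.Equivalent.value_eq_holds heqv
          rwa [hvalR' p hnp, hvalR' p' hnp'] at hv
        have hsplit : a.erase p + Finsupp.single p (a p) = a := Finsupp.erase_add_single p a
        set a' : ℤ × ℤ →₀ ℚ × ℚ := a.erase p + Finsupp.single p' (b₀, b₁) with ha'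
        have hΨ' : Ψ a' = Ψ a :=
          calc Ψ a' = Ψ (a.erase p) + ψ p' (b₀, b₁) := by rw [ha', map_add, hΨ1]
            _ = Ψ (a.erase p) + ψ p (a p) := by rw [key]
            _ = Ψ (a.erase p + Finsupp.single p (a p)) := by rw [map_add, hΨ1]
            _ = Ψ a := by rw [hsplit]
        have hE' : E a' = 0 :=
          calc E a' = E (a.erase p) + ((b₀ : ℝ) * ω p' + (b₁ : ℝ) * η p') := by rw [ha', map_add, hE1]
            _ = E (a.erase p) + (((a p).1 : ℝ) * ω p + ((a p).2 : ℝ) * η p) := by rw [hval]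
            _ = E (a.erase p + Finsupp.single p (a p)) := by rw [map_add, hE1]
            _ = 0 := by rw [hsplit, hEa]
        have hsupp' : a'.support ⊆ a.support.erase p := by
          intro x hx
          rcases Finset.mem_union.1 (Finsupp.support_add hx) with h | h
          · rwa [Finsupp.support_erase] at h
          · have hx' := Finsupp.support_single_subset h
            rw [Finset.mem_singleton] at hx'
            rw [hx', Finset.mem_erase]
            exact ⟨fun h' => hpp' h'.symm, hp'⟩
        have hcard' : a'.support.card ≤ n := by
          have h1 := Finset.card_le_card hsupp'
          rw [Finset.card_erase_of_mem hp] at h1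
          omega
        have hns' : ∀ x ∈ a'.support, 4 * x.1 ^ 3 + 27 * x.2 ^ 2 < 0 :=
          fun x hx => hns x (Finset.mem_of_mem_erase (hsupp' hx))
        rw [← hΨ']
        exact ih a' hcard' hns' hE'
      · -- pairwise non-joined support: (I) kills every coefficient, so the support is empty
        set k : ℕ := a.support.card with hk
        let e : Fin k ≃ {x // x ∈ a.support} := a.support.equivFin.symm
        have hzero := hI k (fun i => (e i).1.1) (fun i => (e i).1.2) (fun i => (a (e i).1).1)
          (fun i => (a (e i).1).2) (fun i => hns _ (e i).2) ?_ ?_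
        · have hk0 : k = 0 := by
            by_contra hk0
            have i : Fin k := ⟨0, Nat.pos_of_ne_zero hk0⟩
            exact (Finsupp.mem_support_iff.1 (e i).2) (Prod.ext (hzero i).1 (hzero i).2)
          have ha0 : a = 0 := by
            rw [← Finsupp.support_eq_empty, ← Finset.card_eq_zero]
            exact hk0
          rw [ha0, map_zero]
        · intro i j hij hjoin
          have hne : (e i).1 ≠ (e j).1 := fun h => hij (e.injective (Subtype.ext h))
          exact hrel ⟨(e i).1, (e i).2, (e j).1, (e j).2, hne, hjoin⟩
        · -- the value: `∑ᵢ (a(eᵢ).1 Ω(eᵢ) + a(eᵢ).2 H(eᵢ)) = E a = 0`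
          have h1 : ∑ i : Fin k, (((a (e i).1).1 : ℝ) * ω (e i).1 + ((a (e i).1).2 : ℝ) * η (e i).1) =
              ∑ x ∈ a.support, (((a x).1 : ℝ) * ω x + ((a x).2 : ℝ) * η x) := by
            rw [Equiv.sum_comp e (fun x => ((a x.1).1 : ℝ) * ω x.1 + ((a x.1).2 : ℝ) * η x.1)]
            exact Finset.sum_coe_sort a.support (fun x => ((a x).1 : ℝ) * ω x + ((a x).2 : ℝ) * η x)
          change ∑ i : Fin k, (((a (e i).1).1 : ℝ) * ω (e i).1 + ((a (e i).1).2 : ℝ) * η (e i).1) = 0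
          rw [h1, ← hEsum, hEa]
  -- conclusion
  obtain ⟨a, ha, hπa, hEa⟩ := stepA c hc
  have hΨa : Ψ a = 0 := stepB _ a le_rfl ha (by rw [← hEa, hc0])
  have : π c = 0 := by rw [hπa, hΨa]
  rwa [hπ] at this

end Summit.KontsevichZagierPeriods.IsogenyCertificates.XMapKernelStubs.EtaCellCollapse
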